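import Mathlib.Analysis.InnerProductSpace.PiL2
import Mathlib.Topology.MetricSpace.Lipschitz
import Mathlib.Topology.Algebra.Order.LiminfLimsup
import HarnessLib

/-!
# Tao (2011/2013), proof of Thm. 10.1: the time-varying Lipschitz cutoff (annular form)

A proved brick of the printed proof of Tao 2011, **Thm. 10.1** (arXiv:1108.1165, §10,
pp. 30–31), in the annular geometry of **Remark 10.6** (arXiv Rem. 64, p. 33). Tao (ball case):
"We introduce a time-varying Lipschitz continuous cutoff function
`η(t,x) = min(max(0, c^{-0.1}δ²(R'(t) − |x|)), 1)`. This function is supported on the ball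
`B(0, R'(t))` and equals one on `B(0, R'(t) − c^{0.1}δ^{-2})`, and is radially decreasing […] As
`t` increases, this cutoff shrinks at speed `c⁻¹‖u(t)‖_{L^∞_x(ℝ³)}`"; Remark 10.6: for an annulus
one uses "a slightly more complicated cutoff (which is shrinking inside the annulus
`B(x₀,R') \ B(x₀,R)` towards the smaller annulus `B(x₀,R'−r) \ B(x₀,R+r)`)". We fix this cutoff
as the radial profile

  `annularRamp k a b ρ = min(1, max(0, k(b − ρ)), max(0, k(ρ − a)))`

(slope `k = c^{-0.1}δ²`; `k` is written for Tao's slope since `λ` is a Lean keyword, inner radius `a`, outer radius `b`; it vanishes for `ρ ∉ (a, b)`, equals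
`1` for `a + k⁻¹ ≤ ρ ≤ b − k⁻¹`, and is `k`-Lipschitz), evaluated at `ρ = ‖x − x₀‖` with
time-dependent radii `a = ρ₁(t)` (nondecreasing) and `b = ρ₂(t)` (nonincreasing):
`movingCutoff x₀ k ρ₁ ρ₂ t x`. In §10 one takes `ρ₁(t) = R₁' + c⁻¹σ(t)`, `ρ₂(t) = R₂' − c⁻¹σ(t)`
with `σ(t) = ∫₀ᵗ‖u(s)‖_{L^∞} ds` the speed integral (`TaoSpeedIntegral.lean`). This file proves
the elementary properties used in §10: `0 ≤ η ≤ 1`, the support and plateau statements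
("supported on …, equals one on …"), the Lipschitz bound in `x` with constant `k`, monotonicity
in the radii (hence `η(t, x)` is nonincreasing in `t`: the recession term `Y₂ ≥ 0`), the
Lipschitz dependence on the radii (whence absolute continuity in `t` along an absolutely
continuous `σ`), and joint continuity.

## Mathlib / tree search

Tree: `NS.taoCutoff` (`TaoEnergyLocalisation.lean`) is the *smooth static* cutoff `χ((|x|−R)/r)`
of §8; no Lipschitz/time-dependent cutoff (`lean search 'Lipschitz.*cutoff|movingCutoff|ramp'`).
Mathlib: `LipschitzWith.min_const`/`max_const`, `LipschitzWith.comp`, `lipschitzWith_one_norm`.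

## References

* T. Tao, *Localisation and compactness properties of the Navier–Stokes global regularity
  problem*, Anal. PDE 6 (2013) 25–107 = arXiv:1108.1165 (`Tao2011`), §10, proof of Thm. 10.1
  (arXiv pp. 30–31, the cutoff `η` and (10.12)), Remark 10.6 (arXiv Rem. 64, p. 33).
-/

noncomputable section

open Set Function Filter Topology
open scoped NNReal

namespace Literature.Analysis.FluidPDE

/-- Local notation for physical space `ℝ³ = EuclideanSpace ℝ (Fin 3)`. -/
local notation "ℝ³" => EuclideanSpace ℝ (Fin 3)

/-! ## The radial profile -/

/-- **The annular ramp profile** `min(1, max(0, k(b − ρ)), max(0, k(ρ − a)))`: zero for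
`ρ ≤ a` and `ρ ≥ b`, rising with slope `k` on `[a, a + k⁻¹]`, equal to `1` on
`[a + k⁻¹, b − k⁻¹]`, falling with slope `−k` on `[b − k⁻¹, b]` (Tao's
`min(max(0, c^{-0.1}δ²(R'(t) − |x|)), 1)`, made two-sided for the annulus of Remark 10.6). [cite: Tao2011, §10, proof of Thm. 10.1 (the cutoff η) + Remark 10.6] -/
def annularRamp (k a b ρ : ℝ) : ℝ :=
  min 1 (min (max 0 (k * (b - ρ))) (max 0 (k * (ρ - a))))

section Ramp

variable {k a b ρ : ℝ}

/-- Unfolding `annularRamp`. [folklore] -/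
theorem annularRamp_def (k a b ρ : ℝ) :
    annularRamp k a b ρ = min 1 (min (max 0 (k * (b - ρ))) (max 0 (k * (ρ - a)))) := rfl

/-- The profile is nonnegative. [folklore] -/
theorem annularRamp_nonneg (k a b ρ : ℝ) : 0 ≤ annularRamp k a b ρ :=
  le_min zero_le_one (le_min (le_max_left _ _) (le_max_left _ _))

/-- The profile is at most `1`. [folklore] -/
theorem annularRamp_le_one (k a b ρ : ℝ) : annularRamp k a b ρ ≤ 1 := min_le_left _ _

/-- The profile vanishes inside the inner radius. [folklore] -/
theorem annularRamp_eq_zero_of_le_inner (hk : 0 ≤ k) (h : ρ ≤ a) : annularRamp k a b ρ = 0 := by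
  have h1 : max 0 (k * (ρ - a)) = 0 := max_eq_left (mul_nonpos_of_nonneg_of_nonpos hk (by linarith))
  refine le_antisymm ?_ (annularRamp_nonneg k a b ρ)
  calc annularRamp k a b ρ ≤ min (max 0 (k * (b - ρ))) (max 0 (k * (ρ - a))) := min_le_right _ _
    _ ≤ max 0 (k * (ρ - a)) := min_le_right _ _
    _ = 0 := h1

/-- The profile vanishes outside the outer radius. [folklore] -/
theorem annularRamp_eq_zero_of_outer_le (hk : 0 ≤ k) (h : b ≤ ρ) : annularRamp k a b ρ = 0 := by
  have h1 : max 0 (k * (b - ρ)) = 0 := max_eq_left (mul_nonpos_of_nonneg_of_nonpos hk (by linarith))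
  refine le_antisymm ?_ (annularRamp_nonneg k a b ρ)
  calc annularRamp k a b ρ ≤ min (max 0 (k * (b - ρ))) (max 0 (k * (ρ - a))) := min_le_right _ _
    _ ≤ max 0 (k * (b - ρ)) := min_le_left _ _
    _ = 0 := h1

/-- Where the profile is nonzero, `a < ρ < b`. [folklore] -/
theorem inner_lt_of_annularRamp_ne_zero (hk : 0 ≤ k) (h : annularRamp k a b ρ ≠ 0) : a < ρ := by
  by_contra hc
  exact h (annularRamp_eq_zero_of_le_inner hk (not_lt.1 hc))

/-- Where the profile is nonzero, `ρ < b`. [folklore] -/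
theorem lt_outer_of_annularRamp_ne_zero (hk : 0 ≤ k) (h : annularRamp k a b ρ ≠ 0) : ρ < b := by
  by_contra hc
  exact h (annularRamp_eq_zero_of_outer_le hk (not_lt.1 hc))

/-- The plateau: the profile equals `1` for `a + k⁻¹ ≤ ρ ≤ b − k⁻¹` (`k > 0`). [folklore] -/
theorem annularRamp_eq_one (hk : 0 < k) (h₁ : a + k⁻¹ ≤ ρ) (h₂ : ρ ≤ b - k⁻¹) :
    annularRamp k a b ρ = 1 := by
  have e : k * k⁻¹ = 1 := mul_inv_cancel₀ hk.ne'
  have h1 : 1 ≤ k * (b - ρ) := by nlinarith [mul_le_mul_of_nonneg_left (by linarith : k⁻¹ ≤ b - ρ) hk.le]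
  have h2 : 1 ≤ k * (ρ - a) := by nlinarith [mul_le_mul_of_nonneg_left (by linarith : k⁻¹ ≤ ρ - a) hk.le]
  rw [annularRamp_def]
  refine min_eq_left (le_min ?_ ?_)
  · exact h1.trans (le_max_right _ _)
  · exact h2.trans (le_max_right _ _)

/-- On the outer transition layer `b − k⁻¹ ≤ ρ ≤ b` (and above the inner layer) the profile is
the linear ramp `k(b − ρ)`. [folklore] -/
theorem annularRamp_eq_outer (hk : 0 < k) (h₁ : a + k⁻¹ ≤ ρ) (h₂ : b - k⁻¹ ≤ ρ) (h₃ : ρ ≤ b) :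
    annularRamp k a b ρ = k * (b - ρ) := by
  have e : k * k⁻¹ = 1 := mul_inv_cancel₀ hk.ne'
  have h0 : 0 ≤ k * (b - ρ) := mul_nonneg hk.le (by linarith)
  have h1 : k * (b - ρ) ≤ 1 := by nlinarith [mul_le_mul_of_nonneg_left (by linarith : b - ρ ≤ k⁻¹) hk.le]
  have h2 : 1 ≤ k * (ρ - a) := by nlinarith [mul_le_mul_of_nonneg_left (by linarith : k⁻¹ ≤ ρ - a) hk.le]
  rw [annularRamp_def, max_eq_right h0, max_eq_right (zero_le_one.trans h2),
    min_eq_left (h1.trans h2), min_eq_right h1]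

/-- On the inner transition layer `a ≤ ρ ≤ a + k⁻¹` (and below the outer layer) the profile is
the linear ramp `k(ρ − a)`. [folklore] -/
theorem annularRamp_eq_inner (hk : 0 < k) (h₁ : a ≤ ρ) (h₂ : ρ ≤ a + k⁻¹) (h₃ : ρ ≤ b - k⁻¹) :
    annularRamp k a b ρ = k * (ρ - a) := by
  have e : k * k⁻¹ = 1 := mul_inv_cancel₀ hk.ne'
  have h0 : 0 ≤ k * (ρ - a) := mul_nonneg hk.le (by linarith)
  have h1 : k * (ρ - a) ≤ 1 := by nlinarith [mul_le_mul_of_nonneg_left (by linarith : ρ - a ≤ k⁻¹) hk.le]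
  have h2 : 1 ≤ k * (b - ρ) := by nlinarith [mul_le_mul_of_nonneg_left (by linarith : k⁻¹ ≤ b - ρ) hk.le]
  rw [annularRamp_def, max_eq_right h0, max_eq_right (zero_le_one.trans h2),
    min_eq_right (h2.trans' h1), min_eq_right h1]

/-- The profile is `k`-Lipschitz in the radial variable (`k ≥ 0`). [folklore] -/
theorem lipschitzWith_annularRamp (hk : 0 ≤ k) (a b : ℝ) :
    LipschitzWith (Real.toNNReal k) (annularRamp k a b) := by
  have hlin₁ : LipschitzWith (Real.toNNReal k) (fun ρ : ℝ => k * (b - ρ)) := by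
    refine LipschitzWith.of_dist_le_mul fun x y => ?_
    rw [Real.dist_eq, Real.dist_eq, Real.coe_toNNReal k hk,
      show k * (b - x) - k * (b - y) = k * (y - x) by ring, abs_mul, abs_of_nonneg hk, abs_sub_comm]
  have hlin₂ : LipschitzWith (Real.toNNReal k) (fun ρ : ℝ => k * (ρ - a)) := by
    refine LipschitzWith.of_dist_le_mul fun x y => ?_
    rw [Real.dist_eq, Real.dist_eq, Real.coe_toNNReal k hk,
      show k * (x - a) - k * (y - a) = k * (x - y) by ring, abs_mul, abs_of_nonneg hk]
  have h := ((hlin₁.const_max 0).min (hlin₂.const_max 0)).const_min 1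
  rw [max_self] at h
  exact h

/-- The profile is continuous in the radial variable. [folklore] -/
theorem continuous_annularRamp (hk : 0 ≤ k) (a b : ℝ) : Continuous (annularRamp k a b) :=
  (lipschitzWith_annularRamp hk a b).continuous

/-- The profile is jointly continuous in `(a, b, ρ)`. [folklore] -/
theorem continuous_annularRamp_uncurry (k : ℝ) :
    Continuous fun p : ℝ × ℝ × ℝ => annularRamp k p.1 p.2.1 p.2.2 := by
  unfold annularRamp
  fun_prop

/-- Monotonicity in the radii: enlarging the annulus (`a' ≤ a`, `b ≤ b'`) increases the
profile. In §10 the inner radius grows and the outer radius shrinks in time, so `η(t, x)` is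
nonincreasing in `t`. [folklore] -/
theorem annularRamp_mono_radii (hk : 0 ≤ k) {a a' b b' : ℝ} (ha : a' ≤ a) (hb : b ≤ b') (ρ : ℝ) :
    annularRamp k a b ρ ≤ annularRamp k a' b' ρ := by
  unfold annularRamp
  have h1 : k * (b - ρ) ≤ k * (b' - ρ) := mul_le_mul_of_nonneg_left (by linarith) hk
  have h2 : k * (ρ - a) ≤ k * (ρ - a') := mul_le_mul_of_nonneg_left (by linarith) hk
  exact min_le_min le_rfl (min_le_min (max_le_max le_rfl h1) (max_le_max le_rfl h2))

/-- Lipschitz dependence on the radii: moving both radii by at most `d` changes the profile by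
at most `k d`. Along `a = R₁' + c⁻¹σ(t)`, `b = R₂' − c⁻¹σ(t)` this makes `t ↦ η(t, x)` absolutely
continuous whenever `σ` is, with `|∂ₜη| ≤ c⁻¹k σ'(t)` — cf. (10.12). [folklore] -/
theorem abs_annularRamp_sub_le (hk : 0 ≤ k) {a a' b b' d : ℝ} (ha : |a - a'| ≤ d) (hb : |b - b'| ≤ d)
    (ρ : ℝ) : |annularRamp k a b ρ - annularRamp k a' b' ρ| ≤ k * d := by
  -- `min`/`max` are 1-Lipschitz in each argument
  have key : ∀ (p q p' q' : ℝ), |p - p'| ≤ k * d → |q - q'| ≤ k * d →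
      |min 1 (min (max 0 p) (max 0 q)) - min 1 (min (max 0 p') (max 0 q'))| ≤ k * d := by
    intro p q p' q' hp hq
    have h1 : |max 0 p - max 0 p'| ≤ k * d := by
      rw [max_comm 0 p, max_comm 0 p']; exact (abs_max_sub_max_le_abs _ _ _).trans hp
    have h2 : |max 0 q - max 0 q'| ≤ k * d := by
      rw [max_comm 0 q, max_comm 0 q']; exact (abs_max_sub_max_le_abs _ _ _).trans hq
    have h3 : |min (max 0 p) (max 0 q) - min (max 0 p') (max 0 q')| ≤ k * d :=
      (abs_min_sub_min_le_max _ _ _ _).trans (max_le h1 h2)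
    calc |min 1 (min (max 0 p) (max 0 q)) - min 1 (min (max 0 p') (max 0 q'))|
        ≤ max |(1 : ℝ) - 1| |min (max 0 p) (max 0 q) - min (max 0 p') (max 0 q')| :=
          abs_min_sub_min_le_max _ _ _ _
      _ ≤ k * d := by rw [sub_self, abs_zero]; exact max_le (by nlinarith [abs_nonneg (a - a')]) h3
  refine key _ _ _ _ ?_ ?_
  · rw [show k * (b - ρ) - k * (b' - ρ) = k * (b - b') by ring, abs_mul, abs_of_nonneg hk]
    exact mul_le_mul_of_nonneg_left hb hk
  · rw [show k * (ρ - a) - k * (ρ - a') = k * (a' - a) by ring, abs_mul, abs_of_nonneg hk,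
      abs_sub_comm]
    exact mul_le_mul_of_nonneg_left ha hk

end Ramp

/-! ## The moving cutoff on `ℝ³` -/

/-- **Tao's time-varying Lipschitz cutoff, annular form**:
`η(t, x) = annularRamp k (ρ₁ t) (ρ₂ t) ‖x − x₀‖` with inner radius `ρ₁(t)` and outer radius
`ρ₂(t)`; in §10 / Remark 10.6, `k = c^{-0.1}δ²`, `ρ₁(t) = R₁' + c⁻¹∫₀ᵗ‖u‖_{L^∞}`,
`ρ₂(t) = R₂' − c⁻¹∫₀ᵗ‖u‖_{L^∞}`. [cite: Tao2011, §10, proof of Thm. 10.1 (the cutoff η) + Remark 10.6] -/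
def movingCutoff (x₀ : ℝ³) (k : ℝ) (ρ₁ ρ₂ : ℝ → ℝ) (t : ℝ) (x : ℝ³) : ℝ :=
  annularRamp k (ρ₁ t) (ρ₂ t) ‖x - x₀‖

section Moving

variable {x₀ : ℝ³} {k : ℝ} {ρ₁ ρ₂ : ℝ → ℝ} {t : ℝ} {x : ℝ³}

/-- Unfolding `movingCutoff`. [folklore] -/
theorem movingCutoff_apply (x₀ : ℝ³) (k : ℝ) (ρ₁ ρ₂ : ℝ → ℝ) (t : ℝ) (x : ℝ³) :
    movingCutoff x₀ k ρ₁ ρ₂ t x = annularRamp k (ρ₁ t) (ρ₂ t) ‖x - x₀‖ := rfl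

/-- The cutoff is nonnegative. [folklore] -/
theorem movingCutoff_nonneg (x₀ : ℝ³) (k : ℝ) (ρ₁ ρ₂ : ℝ → ℝ) (t : ℝ) (x : ℝ³) :
    0 ≤ movingCutoff x₀ k ρ₁ ρ₂ t x := annularRamp_nonneg _ _ _ _

/-- The cutoff is at most `1`. [folklore] -/
theorem movingCutoff_le_one (x₀ : ℝ³) (k : ℝ) (ρ₁ ρ₂ : ℝ → ℝ) (t : ℝ) (x : ℝ³) :
    movingCutoff x₀ k ρ₁ ρ₂ t x ≤ 1 := annularRamp_le_one _ _ _ _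

/-- "This function is supported on the ball `B(0, R'(t))`": the cutoff vanishes off the open
annulus `ρ₁(t) < ‖x − x₀‖ < ρ₂(t)`. [cite: Tao2011, §10, proof of Thm. 10.1 (the cutoff η)] -/
theorem movingCutoff_eq_zero_of_not_mem (hk : 0 ≤ k)
    (hx : x ∉ Metric.ball x₀ (ρ₂ t) \ Metric.closedBall x₀ (ρ₁ t)) :
    movingCutoff x₀ k ρ₁ ρ₂ t x = 0 := by
  rw [Set.mem_sdiff, Metric.mem_ball, Metric.mem_closedBall, dist_eq_norm, not_and, not_not] at hx
  by_cases h : ‖x - x₀‖ < ρ₂ t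
  · exact annularRamp_eq_zero_of_le_inner hk (hx h)
  · exact annularRamp_eq_zero_of_outer_le hk (not_lt.1 h)

/-- The support of a slice of the cutoff lies in the open annulus `ρ₁(t) < ‖x − x₀‖ < ρ₂(t)`. [folklore] -/
theorem support_movingCutoff_subset (hk : 0 ≤ k) :
    support (movingCutoff x₀ k ρ₁ ρ₂ t) ⊆ Metric.ball x₀ (ρ₂ t) \ Metric.closedBall x₀ (ρ₁ t) :=
  fun _ hx => by_contra fun h => hx (movingCutoff_eq_zero_of_not_mem hk h)

/-- The topological support of a slice lies in the closed ball `B̄(x₀, ρ₂(t))`. [folklore] -/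
theorem tsupport_movingCutoff_subset (hk : 0 ≤ k) :
    tsupport (movingCutoff x₀ k ρ₁ ρ₂ t) ⊆ Metric.closedBall x₀ (ρ₂ t) :=
  closure_minimal ((support_movingCutoff_subset hk).trans
    (Set.sdiff_subset.trans Metric.ball_subset_closedBall)) Metric.isClosed_closedBall

/-- The slices of the cutoff have compact support. [folklore] -/
theorem hasCompactSupport_movingCutoff (hk : 0 ≤ k) :
    HasCompactSupport (movingCutoff x₀ k ρ₁ ρ₂ t) :=
  HasCompactSupport.of_support_subset_isCompact (isCompact_closedBall x₀ (ρ₂ t))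
    ((support_movingCutoff_subset hk).trans (Set.sdiff_subset.trans Metric.ball_subset_closedBall))

/-- "and equals one on `B(0, R'(t) − c^{0.1}δ^{-2})`": the cutoff equals `1` on the plateau
annulus `ρ₁(t) + k⁻¹ ≤ ‖x − x₀‖ ≤ ρ₂(t) − k⁻¹`. [cite: Tao2011, §10, proof of Thm. 10.1 (the cutoff η)] -/
theorem movingCutoff_eq_one (hk : 0 < k) (h₁ : ρ₁ t + k⁻¹ ≤ ‖x - x₀‖)
    (h₂ : ‖x - x₀‖ ≤ ρ₂ t - k⁻¹) : movingCutoff x₀ k ρ₁ ρ₂ t x = 1 :=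
  annularRamp_eq_one hk h₁ h₂

/-- "Lipschitz continuous cutoff": each slice is `k`-Lipschitz in `x`
(`|∇ₓη| ≤ k = c^{-0.1}δ²` a.e.). [cite: Tao2011, §10, proof of Thm. 10.1 (the cutoff η)] -/
theorem lipschitzWith_movingCutoff (hk : 0 ≤ k) (x₀ : ℝ³) (ρ₁ ρ₂ : ℝ → ℝ) (t : ℝ) :
    LipschitzWith (Real.toNNReal k) (movingCutoff x₀ k ρ₁ ρ₂ t) := by
  have h1 : LipschitzWith 1 fun x : ℝ³ => ‖x - x₀‖ :=
    LipschitzWith.of_dist_le_mul fun x y => by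
      rw [Real.dist_eq, NNReal.coe_one, one_mul, dist_eq_norm]
      simpa [sub_sub_sub_cancel_right] using abs_norm_sub_norm_le (x - x₀) (y - x₀)
  have h := (lipschitzWith_annularRamp hk (ρ₁ t) (ρ₂ t)).comp h1
  rw [mul_one] at h
  exact h

/-- Each slice of the cutoff is continuous. [folklore] -/
theorem continuous_movingCutoff_slice (hk : 0 ≤ k) (x₀ : ℝ³) (ρ₁ ρ₂ : ℝ → ℝ) (t : ℝ) :
    Continuous (movingCutoff x₀ k ρ₁ ρ₂ t) :=
  (lipschitzWith_movingCutoff hk x₀ ρ₁ ρ₂ t).continuous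

/-- "As `t` increases, this cutoff shrinks": if the inner radius is nondecreasing and the outer
radius nonincreasing on a time set `S`, then `η(t, x) ≤ η(s, x)` for `s ≤ t` in `S` (so the
recession term `Y₂ = −½∫|ω|²∂ₜη` is nonnegative). [cite: Tao2011, §10, proof of Thm. 10.1 ((10.12) and Y₂ ≥ 0)] -/
theorem movingCutoff_antitoneOn (hk : 0 ≤ k) {S : Set ℝ} (h₁ : MonotoneOn ρ₁ S)
    (h₂ : AntitoneOn ρ₂ S) (x : ℝ³) : AntitoneOn (fun t => movingCutoff x₀ k ρ₁ ρ₂ t x) S :=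
  fun _ hs _ ht hst => annularRamp_mono_radii hk (h₁ hs ht hst) (h₂ hs ht hst) _

/-- Lipschitz dependence on time through the radii: if both radii move by at most `d` between
`s` and `t`, the cutoff changes by at most `kd` at every point. With
`ρ₁ = R₁' + c⁻¹σ`, `ρ₂ = R₂' − c⁻¹σ`: `|η(t,x) − η(s,x)| ≤ c⁻¹k|σ(t) − σ(s)|`. [cite: Tao2011, §10, proof of Thm. 10.1 ((10.12))] -/
theorem abs_movingCutoff_sub_le (hk : 0 ≤ k) {s d : ℝ} (h₁ : |ρ₁ t - ρ₁ s| ≤ d)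
    (h₂ : |ρ₂ t - ρ₂ s| ≤ d) (x : ℝ³) :
    |movingCutoff x₀ k ρ₁ ρ₂ t x - movingCutoff x₀ k ρ₁ ρ₂ s x| ≤ k * d :=
  abs_annularRamp_sub_le hk h₁ h₂ _

/-- The speed-driven radii of §10: `ρ₁ = R₁' + c⁻¹σ`, `ρ₂ = R₂' − c⁻¹σ`; then
`|η(t,x) − η(s,x)| ≤ c⁻¹k|σ(t) − σ(s)|`. [cite: Tao2011, §10, proof of Thm. 10.1 ((10.12))] -/
theorem abs_movingCutoff_speedRadii_sub_le (hk : 0 ≤ k) {c R₁' R₂' : ℝ} (hc : 0 < c)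
    (σ : ℝ → ℝ) (s t : ℝ) (x : ℝ³) :
    |movingCutoff x₀ k (fun τ => R₁' + σ τ / c) (fun τ => R₂' - σ τ / c) t x -
        movingCutoff x₀ k (fun τ => R₁' + σ τ / c) (fun τ => R₂' - σ τ / c) s x| ≤
      k * (|σ t - σ s| / c) := by
  refine abs_movingCutoff_sub_le hk (le_of_eq ?_) (le_of_eq ?_) x
  · rw [show R₁' + σ t / c - (R₁' + σ s / c) = (σ t - σ s) / c by ring, abs_div, abs_of_pos hc]
  · rw [show R₂' - σ t / c - (R₂' - σ s / c) = -((σ t - σ s) / c) by ring, abs_neg, abs_div,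
      abs_of_pos hc]

/-- Joint continuity of the cutoff in `(t, x)` when the radii are continuous. [folklore] -/
theorem continuous_movingCutoff_uncurry (k : ℝ) (h₁ : Continuous ρ₁) (h₂ : Continuous ρ₂) :
    Continuous (uncurry (movingCutoff x₀ k ρ₁ ρ₂)) := by
  have h : Continuous fun z : ℝ × ℝ³ => (ρ₁ z.1, ρ₂ z.1, ‖z.2 - x₀‖) := by fun_prop
  exact (continuous_annularRamp_uncurry k).comp h

/-- Joint continuity on a time set `S × ℝ³` when the radii are continuous on `S`. [folklore] -/
theorem continuousOn_movingCutoff_uncurry (k : ℝ) {S : Set ℝ} (h₁ : ContinuousOn ρ₁ S)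
    (h₂ : ContinuousOn ρ₂ S) :
    ContinuousOn (uncurry (movingCutoff x₀ k ρ₁ ρ₂)) (S ×ˢ univ) := by
  have h : ContinuousOn (fun z : ℝ × ℝ³ => (ρ₁ z.1, ρ₂ z.1, ‖z.2 - x₀‖)) (S ×ˢ univ) := by
    refine ContinuousOn.prodMk ?_ (ContinuousOn.prodMk ?_ ?_)
    · exact h₁.comp continuous_fst.continuousOn fun z hz => hz.1
    · exact h₂.comp continuous_fst.continuousOn fun z hz => hz.1
    · exact (continuous_norm.comp (continuous_snd.sub continuous_const)).continuousOn
  exact (continuous_annularRamp_uncurry k).comp_continuousOn h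

end Moving

end Literature.Analysis.FluidPDE

end
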